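import Summits.SmoothPoincare4.SmoothPoincare4.Theorems.RootDecompAEDoublesShadowTwoRoeTwins

/-!
# Grade-two dichotomy for KMN encoding graphs (Roe certificates), part 2/17: twins of the certificate format and the statement; free-group bookkeeping; local certificates

Verbatim twins of §4a–§4b of the skeleton (`Roe.substHom`, `Roe.Step`, `Roe.Valid`, `Roe.HasCertificate`,
`GradeTwoDichotomy`, re-certified by `Iff.rfl`); §2 signed words, exponent sums and `H₁ = 0 ⟹` unimodular exponent
matrix; §4 the decidable LOCAL CERTIFICATE format `LStep` / `lcheck` / `LocalCert` of a piece, local minors `pexp` /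
`minor`, and the hypotheses `TableHyp` of the local table with their normal forms by rank.

THE FAMILY (16 modules `Theorems/RootDecompAEDoublesShadowTwoRoe*.lean` + the closing module
`Theorems/RootDecompAEDoublesShadowTwoStubGradeTwoDichotomy.lean`, one namespace
`Summit.SmoothPoincare4.SmoothPoincare4.Theorems.RootDecompAEDoublesShadowTwoStubGradeTwoDichotomy`, chained imports,
split by topic to respect the 400-line bound on proof files; the local-table parts import only `…RoeDefs`).
-/

open Function
open Literature.Topology.FourManifolds

set_option linter.dupNamespace false

noncomputable section

namespace Summit.SmoothPoincare4.SmoothPoincare4.Theorems.RootDecompAEDoublesShadowTwoStubGradeTwoDichotomy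

namespace Roe

variable {n : ℕ}

/-- The substitution `x ↦ W⁻¹`, all other letters fixed. -/
def substHom (x : Fin n) (W : FreeGroup (Fin n)) : FreeGroup (Fin n) →* FreeGroup (Fin n) :=
  FreeGroup.lift fun y => if y = x then W⁻¹ else FreeGroup.of y

/-- One elimination step: relator index, eliminated letter, the complementary word, and a sign. -/
structure Step (n : ℕ) where
  /-- the relator used at this step -/
  rel : Fin n
  /-- the letter eliminated at this step -/
  letter : Fin n
  /-- the word `W` with `relator ~ (letter · W)^{±1}` -/
  word : FreeGroup (Fin n)
  /-- `true`: the relator is conjugate to `letter · W`; `false`: to its inverse -/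
  sgn : Bool

/-- VALIDITY of a step list from a state (accumulated substitution `Φ`, eliminated letters `E`, used relators `U`):
the next relator, AFTER the substitutions so far, is conjugate to `(x · W)^{±1}` with `x` fresh and `W` a word in the
letters that are neither eliminated nor `x`; then `x ↦ W⁻¹` is composed into `Φ`.  At the end every letter is eliminated
and every relator used. -/
def Valid (P : BalancedPresentation n) :
    List (Step n) → (FreeGroup (Fin n) →* FreeGroup (Fin n)) → Finset (Fin n) → Finset (Fin n) → Prop
  | [], _, E, U => E = Finset.univ ∧ U = Finset.univ
  | s :: rest, Φ, E, U =>
      s.letter ∉ E ∧ s.rel ∉ U ∧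
      s.word ∈ Subgroup.closure (FreeGroup.of '' {y : Fin n | y ∉ E ∧ y ≠ s.letter}) ∧
      IsConj (Φ (P s.rel))
        (if s.sgn then FreeGroup.of s.letter * s.word else (FreeGroup.of s.letter * s.word)⁻¹) ∧
      Valid P rest ((substHom s.letter s.word).comp Φ) (insert s.letter E) (insert s.rel U)

/-- `P` admits a recursive one-occurrence elimination certificate.  (The grade-one ERASURE certificates of gen 12 —
`IsConj (erase_{rk < rk i} (P (σ i))) (xᵢ^{±1})` — are the special case `W = 1` at every step.) -/
def HasCertificate (P : BalancedPresentation n) : Prop :=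
  ∃ steps : List (Step n), Valid P steps (MonoidHom.id _) ∅ ∅

end Roe

/-- STATEMENT OF STUB 2 (LOAD-BEARING, combinatorial — the grade-two DICHOTOMY in certificate form): the presentation of an
admissible grade-two encoding graph that presents the trivial group admits an elimination certificate. -/
def GradeTwoDichotomy : Prop :=
  ∀ (G : ShadowGraph) (n : ℕ) (eg : G.Gen ≃ Fin n) (er : G.Rel ≃ Fin n),
    G.Admissible → (G.presentation eg er).PresentsTrivialGroup → Roe.HasCertificate (G.presentation eg er)

/-- Re-certification of the statement text of the registered stub: `GradeTwoDichotomy` unfolds, by `Iff.rfl`, to the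
quantified certificate statement over the twinned `ShadowGraph` encoding and the twinned `Roe.HasCertificate`. -/
example : GradeTwoDichotomy ↔
    ∀ (G : ShadowGraph) (n : ℕ) (eg : G.Gen ≃ Fin n) (er : G.Rel ≃ Fin n),
      G.Admissible → (G.presentation eg er).PresentsTrivialGroup → Roe.HasCertificate (G.presentation eg er) :=
  Iff.rfl

/-! ## §2 Free-group bookkeeping: signed words, exponent sums, and `H₁ = 0 ⟹ unimodular exponent matrix` -/

section FreeGroupLemmas

variable {ι : Type} [DecidableEq ι]

/-- A word or its inverse, selected by a Boolean sign. -/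
def sgnw {α : Type} (t : Bool) (w : FreeGroup α) : FreeGroup α := if t then w⁻¹ else w

/-- `sgnw` in a free group, as an `if`. -/
theorem sgnw_eq_ite {α : Type} (t : Bool) (w : FreeGroup α) : sgnw t w = if t then w⁻¹ else w := rfl

/-- Double sign: `sgnw t (sgnw t' w) = sgnw (t xor t') w`. -/
theorem sgnw_sgnw {α : Type} (t t' : Bool) (w : FreeGroup α) : sgnw t (sgnw t' w) = sgnw (xor t t') w := by
  cases t <;> cases t' <;> simp [sgnw]

/-- The exponent-sum character of the generator `j` (multiplicative notation). -/
def gexp (j : ι) : FreeGroup ι →* Multiplicative ℤ :=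
  FreeGroup.lift fun i => if i = j then Multiplicative.ofAdd 1 else 1

/-- The exponent sum of the generator `j` in the word `w`. -/
def expo (j : ι) (w : FreeGroup ι) : ℤ := Multiplicative.toAdd (gexp j w)

/-- Exponent sum of a letter in a one-letter word. -/
@[simp] theorem expo_of (i j : ι) : expo j (FreeGroup.of i) = if i = j then 1 else 0 := by
  unfold expo gexp
  rw [FreeGroup.lift_apply_of]
  split_ifs <;> rfl

/-- Exponent sums are additive. -/
@[simp] theorem expo_mul (j : ι) (v w : FreeGroup ι) : expo j (v * w) = expo j v + expo j w := by
  unfold expo; rw [map_mul, toAdd_mul]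

/-- Exponent sums change sign under inversion. -/
@[simp] theorem expo_inv (j : ι) (w : FreeGroup ι) : expo j w⁻¹ = -expo j w := by
  unfold expo; rw [map_inv, toAdd_inv]

/-- The empty word has all exponent sums zero. -/
@[simp] theorem expo_one (j : ι) : expo j (1 : FreeGroup ι) = 0 := by
  unfold expo; rw [map_one, toAdd_one]

/-- Exponent sums are conjugation invariant. -/
theorem expo_conj (j : ι) (g w : FreeGroup ι) : expo j (g * w * g⁻¹) = expo j w := by
  simp only [expo_mul, expo_inv]; ring

/-- Exponent sums along a renaming of the generators by an equivalence. -/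
theorem expo_map_equiv {κ : Type} [DecidableEq κ] (e : ι ≃ κ) (j : κ) (w : FreeGroup ι) :
    expo j (FreeGroup.map e w) = expo (e.symm j) w := by
  have h : (gexp j).comp (FreeGroup.map e) = gexp (e.symm j) := by
    refine FreeGroup.ext_hom _ _ fun i => ?_
    simp only [MonoidHom.coe_comp, Function.comp_apply, FreeGroup.map.of, gexp, FreeGroup.lift_apply_of]
    by_cases hij : e i = j
    · have : i = e.symm j := by rw [← hij]; simp
      simp [this]
    · have : i ≠ e.symm j := by rintro rfl; simp at hij
      simp [hij, this]
  unfold expo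
  exact congrArg Multiplicative.toAdd (DFunLike.congr_fun h w)

/-- THE EXPONENT MATRIX of a family of words `R : ι → FreeGroup ι`: entry `(r, j)` is the exponent sum of the
generator `j` in the word `R r`. -/
def expoMat [Fintype ι] (R : ι → FreeGroup ι) : Matrix ι ι ℤ := Matrix.of fun r j => expo j (R r)

/-- The words whose exponent vector is an integer combination of the exponent vectors of the `R r` form a
NORMAL subgroup (it is the preimage of a subgroup of the abelianisation). -/
def combSubgroup [Fintype ι] (R : ι → FreeGroup ι) : Subgroup (FreeGroup ι) where
  carrier := {w | ∃ c : ι → ℤ, ∀ j, expo j w = ∑ r, c r * expo j (R r)}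
  one_mem' := ⟨0, fun j => by simp⟩
  mul_mem' := by
    rintro v w ⟨c, hc⟩ ⟨d, hd⟩
    refine ⟨c + d, fun j => ?_⟩
    simp only [expo_mul, hc, hd, Pi.add_apply, add_mul, Finset.sum_add_distrib]
  inv_mem' := by
    rintro w ⟨c, hc⟩
    refine ⟨-c, fun j => ?_⟩
    simp only [expo_inv, hc, Pi.neg_apply, neg_mul, Finset.sum_neg_distrib]

/-- The kernel of all exponent sums that vanish on the relators is a normal subgroup. -/
theorem combSubgroup_normal [Fintype ι] (R : ι → FreeGroup ι) : (combSubgroup R).Normal := by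
  refine ⟨fun w hw g => ?_⟩
  obtain ⟨c, hc⟩ := hw
  refine ⟨c, fun j => ?_⟩
  rw [expo_conj]
  exact hc j

/-- **`H₁ = 0 ⟹ unimodular`.**  If the words `R r` normally generate the free group (the presentation
`⟨ι ∣ R⟩` is the trivial group), then the exponent matrix is invertible over `ℤ`: its determinant is a unit. -/
theorem isUnit_det_expoMat [Fintype ι] (R : ι → FreeGroup ι)
    (h : Subgroup.normalClosure (Set.range R) = ⊤) : IsUnit (expoMat R).det := by
  classical
  haveI := combSubgroup_normal R
  have hle : Subgroup.normalClosure (Set.range R) ≤ combSubgroup R := by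
    refine Subgroup.normalClosure_le_normal ?_
    rintro _ ⟨r, rfl⟩
    refine ⟨fun r' => if r' = r then 1 else 0, fun j => ?_⟩
    simp [Finset.sum_ite_eq']
  have hmem : ∀ j : ι, ∃ c : ι → ℤ, ∀ j', expo j' (FreeGroup.of j) = ∑ r, c r * expo j' (R r) := by
    intro j
    have : FreeGroup.of j ∈ combSubgroup R := hle (by rw [h]; exact Subgroup.mem_top _)
    exact this
  choose c hc using hmem
  let C : Matrix ι ι ℤ := Matrix.of fun j r => c j r
  have hCM : C * expoMat R = 1 := by
    ext j j'
    rw [Matrix.mul_apply, Matrix.one_apply]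
    have := hc j j'
    rw [expo_of] at this
    simp only [C, expoMat, Matrix.of_apply]
    rw [← this]
  have hdet : C.det * (expoMat R).det = 1 := by rw [← Matrix.det_mul, hCM, Matrix.det_one]
  have hdet' : (expoMat R).det * C.det = 1 := by rw [mul_comm]; exact hdet
  exact ⟨⟨(expoMat R).det, C.det, hdet', hdet⟩, rfl⟩

end FreeGroupLemmas

/-! ## §4 Local elimination certificates of a piece (decidable data) and the local minors -/

section LocalCert

/-- One LOCAL elimination step at a piece: the port whose (substituted, signed) word is used, the letter eliminated, the
complementary word `W` (so that the word is conjugate to `(x · W)^{±1}`), the sign, and an explicit conjugator. -/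
structure LStep where
  /-- port index of the piece -/
  port : ℕ
  /-- the letter eliminated at this step -/
  letter : Fin 3
  /-- the word `W` with `(substituted port word)^{±1} ~ letter · W` -/
  word : FreeGroup (Fin 3)
  /-- `true`: the port word is inverted before comparing -/
  sgn : Bool
  /-- an explicit conjugator exhibiting the conjugacy -/
  conj : FreeGroup (Fin 3)

/-- The substitution of `F₃` killing the letters of a list and fixing the others. -/
def lkill (L : List (Fin 3)) : FreeGroup (Fin 3) →* FreeGroup (Fin 3) :=
  FreeGroup.lift fun y => if y ∈ L then 1 else FreeGroup.of y

/-- THE LOCAL CHECK of a step list against the port words of the piece `p`, from a local state: the values `Λ` of the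
accumulated substitution on the three letters and the list `El` of letters eliminated so far.  Per step: the letter is
fresh; the word is fixed by killing `El` and the letter (so it is a word in the other fresh letters); the explicit
conjugate of the signed, substituted port word IS `x · W`; then `x ↦ W⁻¹` is composed into `Λ`.  At the end all three
letters are eliminated and the accumulated substitution kills every letter. -/
def lcheck (p : Piece) : List LStep → (Fin 3 → FreeGroup (Fin 3)) → List (Fin 3) → Bool
  | [], Λ, El => decide ((0 : Fin 3) ∈ El) && decide ((1 : Fin 3) ∈ El) && decide ((2 : Fin 3) ∈ El) &&
      decide (Λ 0 = 1) && decide (Λ 1 = 1) && decide (Λ 2 = 1)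
  | s :: rest, Λ, El =>
      !decide (s.letter ∈ El) && decide (lkill (s.letter :: El) s.word = s.word) &&
        decide (s.conj * sgnw s.sgn (FreeGroup.lift Λ (p.portWord s.port)) * s.conj⁻¹ =
            FreeGroup.of s.letter * s.word) &&
          lcheck p rest (fun y => Roe.substHom s.letter s.word (Λ y)) (s.letter :: El)

/-- The INITIAL local substitution of a piece: the unused letters (index `≥ rank`) are killed. -/
def linit (p : Piece) : Fin 3 → FreeGroup (Fin 3) := fun j => if p.rank ≤ (j : ℕ) then 1 else FreeGroup.of j

/-- The INITIAL eliminated letters of a piece: its unused letters. -/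
def lunused (p : Piece) : List (Fin 3) := (List.finRange 3).filter fun j => p.rank ≤ (j : ℕ)

/-- A LOCAL CERTIFICATE of the piece `p` for the list of ports `J`: a step list passing the local check from the initial
state whose ports are exactly `J` up to order. -/
def LocalCert (p : Piece) (J : List ℕ) : Prop :=
  ∃ steps : List LStep, lcheck p steps (linit p) (lunused p) = true ∧ (steps.map LStep.port).Perm J

/-- Exponent sum of the letter `l` in the `j`-th port word of `p`. -/
def pexp (p : Piece) (j : ℕ) (l : Fin 3) : ℤ := expo l (p.portWord j)

/-- THE LOCAL MINOR of a list of ports of length `0, 1, 2, 3`: `1`, the exponent of `a`, the `2 × 2` determinant of the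
exponents of `a, b`, the `3 × 3` determinant of the exponents of `a, b, c` (cofactor expansion along the first row). -/
def minor (p : Piece) : List ℕ → ℤ
  | [] => 1
  | [i] => pexp p i 0
  | [i, j] => pexp p i 0 * pexp p j 1 - pexp p i 1 * pexp p j 0
  | [i, j, l] => pexp p i 0 * (pexp p j 1 * pexp p l 2 - pexp p j 2 * pexp p l 1) -
      pexp p i 1 * (pexp p j 0 * pexp p l 2 - pexp p j 2 * pexp p l 0) +
        pexp p i 2 * (pexp p j 0 * pexp p l 1 - pexp p j 1 * pexp p l 0)
  | _ => 0

end LocalCert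

/-! ### The hypotheses of the local table and their normal forms by rank -/

section TableHyps

/-- THE HYPOTHESES OF THE LOCAL TABLE for the port list `J` of the piece `p`: `J` lists `rank p` ports, strictly
increasing, all existing, and the local minor is `±1`. -/
def TableHyp (p : Piece) (J : List ℕ) : Prop :=
  J.length = p.rank ∧ J.Pairwise (· < ·) ∧ (∀ j ∈ J, j < p.numPorts) ∧ (minor p J = 1 ∨ minor p J = -1)

/-- Rank zero: the port list is empty. -/
theorem tableHyp_zero {p : Piece} (hp : p.rank = 0) {J : List ℕ} (h : TableHyp p J) : J = [] := by
  obtain ⟨hl, -, -, -⟩ := h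
  rw [hp] at hl
  exact List.eq_nil_of_length_eq_zero hl

/-- Rank one: one existing port with unit exponent of `a`. -/
theorem tableHyp_one {p : Piece} (hp : p.rank = 1) {J : List ℕ} (h : TableHyp p J) :
    ∃ j₀, J = [j₀] ∧ j₀ < p.numPorts ∧ (minor p [j₀] = 1 ∨ minor p [j₀] = -1) := by
  obtain ⟨hl, -, hlt, hu⟩ := h
  rw [hp] at hl
  match J, hl, hlt, hu with
  | [j₀], _, hlt, hu => exact ⟨j₀, rfl, hlt j₀ (by simp), hu⟩

/-- Rank two: two existing ports `j₀ < j₁` with unimodular `2 × 2` exponent block. -/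
theorem tableHyp_two {p : Piece} (hp : p.rank = 2) {J : List ℕ} (h : TableHyp p J) :
    ∃ j₀ j₁, J = [j₀, j₁] ∧ j₀ < j₁ ∧ j₁ < p.numPorts ∧ (minor p [j₀, j₁] = 1 ∨ minor p [j₀, j₁] = -1) := by
  obtain ⟨hl, hs, hlt, hu⟩ := h
  rw [hp] at hl
  match J, hl, hs, hlt, hu with
  | [j₀, j₁], _, hs, hlt, hu =>
    rw [List.pairwise_cons] at hs
    exact ⟨j₀, j₁, rfl, hs.1 j₁ (by simp), hlt j₁ (by simp), hu⟩

/-- Rank three: three existing ports `j₀ < j₁ < j₂` with unimodular `3 × 3` exponent block. -/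
theorem tableHyp_three {p : Piece} (hp : p.rank = 3) {J : List ℕ} (h : TableHyp p J) :
    ∃ j₀ j₁ j₂, J = [j₀, j₁, j₂] ∧ j₀ < j₁ ∧ j₁ < j₂ ∧ j₂ < p.numPorts ∧
      (minor p [j₀, j₁, j₂] = 1 ∨ minor p [j₀, j₁, j₂] = -1) := by
  obtain ⟨hl, hs, hlt, hu⟩ := h
  rw [hp] at hl
  match J, hl, hs, hlt, hu with
  | [j₀, j₁, j₂], _, hs, hlt, hu =>
    rw [List.pairwise_cons, List.pairwise_cons] at hs
    exact ⟨j₀, j₁, j₂, rfl, hs.1 j₁ (by simp), hs.2.1 j₂ (by simp), hlt j₂ (by simp), hu⟩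

end TableHyps

end Summit.SmoothPoincare4.SmoothPoincare4.Theorems.RootDecompAEDoublesShadowTwoStubGradeTwoDichotomy
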